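import Summits.QuantumFields.YangMills.Theorems.BalabanUVNodesN19TameConditionedHellingerLetter

/-!
# BalabanUVNodes ∕ node N19 (NE7) — THE HELLINGER LETTER FROM WILD MASS AND TAME TILTS, at one key and SUMMED ALONG `K`: idea-3's edition-3 V-side kernel
# (`one_sub_bc_classLaw_le_wild_add_tilts`) and K-summation (`hellingerRate_of_tilts`) with CRIT-1's rider R2 applied — FILE 1b of 2 (composition + K-summation)

Cell `pub-ymgap` (HUMAN RULING D-0062 Track A ∕ director-ym R399 (3a) second-wave width seats), WIDTH SEAT `pub-ymgap-dag-n19-w4` (node n19 = NE7),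
generation g6, CLAIM-1 ∕ INTENT-1 (bus 2026-08-28T08:31Z; 400-line split: 1a = `…N19TameConditionedHellingerLetter` — tame conditioning (R2), conditioned class
laws = restricted class laws, the `W = ∅` V-side from analytic tilts, toy; 1b = THIS FILE).  Route `Summits/QuantumFields/YangMills/Theses/BalabanUVNodes.lean`, key
item K3⁷ `SpineGivenEndpointR13SepCoPH` (stmt-QuantumFields-20544; skeleton of record v5 941dddb108cbaacf, stub 2 `stub_expansion13H`); filed
`--kind proof --supports … --as helper`.  COUNT-NEUTRAL.  THEOREMS ONLY (0 `def`, 0 `instance`, 0 `notation`, 0 `sorry`).  ADDITIVE — imports FILE 1a (p618660) ONLY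
(`one_sub_affinity_classLaw_le_wildMass_add_restricted`, `one_sub_affinity_classLaw_le_of_analytic_tilts` BY NAME; through it this seat's p614272, dag-n20-w5's
`…N20HellingerEndpointKernel`, dag-n19-w2's `…N19AffinityClassIndexLaws`); modifies nothing, re-declares nothing.

WHY (FILE 1a's header has the full record).  CRIT-1 g5's finding F-ed3-1 on idea-3 g12's `HellingerRoadSketch.lean` EDITION 3 (the analytic-tilt letter of
`one_sub_bc_classLaw_le_wild_add_tilts` ∕ `hellingerRate_of_tilts` sits on the FULL class laws, where (KR)+(V‑b) cannot supply it at radius `r₀∕η_K`; the wild set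
is idle) and its certified repair R2 («tame-condition FIRST, tilt SECOND»; `Cruxes/…/Crit1ProbeIdea3g12.lean`) ask for an «ed.4 patch ≈ 40 l.»: restate both theorems
with the tilt letter on the TAME-RESTRICTED class sums.  THIS FILE is that patch as importable theorems, in the lane's spelled-out affinity `Σ_T √(p·q)`:
* §1 ★★★ `one_sub_affinity_classLaw_le_wildMass_add_tameTilts` — ONE `(K,t)`: positive class weights `A, B` on `T`, wild set `W ⊆ T`; tilts `φ_A, φ_B` of the
  TAME-RESTRICTED class sums `Σ_{T∖W} A e^{sh}∕Σ_{T∖W} A`, `Σ_{T∖W} B e^{sh}∕Σ_{T∖W} B` (`h = log B − log A`) complex-differentiable on `|s| ≤ r` with bounds `B_A, B_B`,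
  tame regime `1 − 𝒜_tame ≤ 1∕16` ⇒ `1 − Σ_T √(p_A p_B) ≤ max(Σ_W A∕Σ_T A, Σ_W B∕Σ_T B) + (B_A + B_B)∕(2r²)` (FILE 1a §2 ∘ §3); ★ `sqrt_…` the same in
  √-currency, `√(1 − 𝒜) ≤ √(max wild mass) + √((B_A + B_B)∕2)∕r`; `tameRegime_of_sup_centredIncrement` — the tame regime is NO new letter: a uniform
  `|h_τ − c_tame| ≤ ¼` on tame classes ((V‑b) eventually) gives `1 − 𝒜_tame ≤ 1∕16` (ed.3's `regime_of_wild_add_sup` at `W := ∅`, via dag-n20-w5's log-moment bound).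
* §2 ★★ `affinityDefectLetter_of_tameTilts` — ALONG `K` on the carrier shapes (`T : ℕ → Finset ι`, `A B : ℕ → ℝ → ι → ℝ` positive on `|t| ≤ l₀`): wild sets
  `W K t ⊆ T K`, per-key bounds `wm_K` on both ONE-RUN wild masses with `Σ√wm_K < ∞` ((V‑a)), radii `r_K` with `Σ 1∕r_K < ∞` ((V‑b): `r_K = r₀∕η_K`), ONE tame
  tilt bound `𝔅`, the tame regime from `K₀` on ⇒ `∃ η ≥ 0`, `Σ_K √η_K < ∞`, `1 − Σ_{T K}√(p_{A,K,t} p_{B,K,t}) ≤ η_K` for all `K`, `|t| ≤ l₀`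
  (`η_K = wm_K + 𝔅∕r_K² (+1 on K < K₀)`) — the (H) letter consumed BY NAME by the landed class-law roads (dag-n19-w2 `abs_classLawGap_le_sqrt_one_sub_affinity_sq`
  ⇒ per-set TV `≤ √(2η_K)`; dag-n20-w4 `exists_hybridNE7_of_target_of_classLawTV`); `exists_summable_sqrt_rate` + ★ `hellingerRate_of_tameTilts` give ed.3's own
  conclusion shape (`∃ ρ` summable, `√(1 − 𝒜_K(t)) ≤ ρ_K`).
CREDIT.  F-ed3-1 and R2: CRIT-1 g5; the road, the kernel and the K-summation shape: idea-3 g10–g13 (`YMNodeOIdeate.Idea3.HellingerRoad.hellingerRate_of_tilts`, re-lettered,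
not imported — `Cruxes/` is not importable); consumed by name: dag-n20-w5 g3 (p616874), dag-n19-w2 g5 (p612301), this seat's g5 (p614272).

HONEST FRAMING.  [folklore] finite-sum real analysis on hypothesis SHAPES; every letter (class weights, wild sets and their mass bounds, tilts, radii, `𝔅`, the regime,
the summabilities `Σ√wm_K < ∞` and `Σ 1∕r_K < ∞`) is a HYPOTHESIS produced by nobody — (V‑a) is a one-run letter read on paper only (idea-3 g13's memo), (V‑b) =
(YG) is two-run and UNPRINTED for d = 4, (KR) on tame components is unverified against the datum (typable only once plan v6 exposes the keyed carriers at `wkey`);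
NO estimate of Bałaban's programme is proved; nothing of Bałaban's asserted or instantiated (no `Provisos₁₃CoPH` tuple — K0⁷ OPEN); NE7 ∕ NE7b ∕ NE7c NOT PRINTED as
two-run statements for d = 4 and NOT proved; N19 ∕ N20 ∕ N21 NOT discharged; K3⁷ OPEN, v5 STANDS, not claimed; no summit statement is proved by this seat; counts
UNMOVED (typed 28∕28 · discharged 5∕27, A 5∕28).  One finite four-torus programme at fixed ε — NOT ℝ⁴, NOT infinite volume, NOT OS, NOT a mass gap, NOT the Clay
problem (R4 closes the conditional finite-𝕋⁴ rung `BalabanLadder.UV` only).  0 `def`; 0 `sorry`; standard axioms; no cite tags.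
-/

noncomputable section

namespace Summit.QuantumFields.YangMills.BalabanUVNodes.N19TameConditionedHellingerLetterAlongK

open Finset
open Summit.QuantumFields.YangMills.BalabanUVNodes.N20HellingerEndpointKernel (one_sub_affinity_le_wildMass_add_logMoment)
open Summit.QuantumFields.YangMills.BalabanUVNodes.N19TameConditionedHellingerLetter
  (one_sub_affinity_classLaw_le_wildMass_add_restricted one_sub_affinity_classLaw_le_of_analytic_tilts)

variable {ι : Type*}

/-! ## §1 Composition: WILD MASS + TAME TILTS — the one-`(K,t)` V-side kernel of edition 3, R2-REPAIRED [folklore] -/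

section Composition
variable {T : Finset ι} {A B : ι → ℝ}

/-- **★★★ THE ONE-`(K,t)` HELLINGER LETTER FROM WILD MASS AND TAME TILTS** [folklore; = idea-3 ed.3's `one_sub_bc_classLaw_le_wild_add_tilts` with
CRIT-1 g5's rider R2 applied: «tame-condition FIRST, tilt SECOND»].  Positive class weights `A, B` of the two runs on the keyed class set `T`, a wild
set `W ⊆ T`; the analytic-tilt letter is asked ONLY of the TAME-RESTRICTED class sums `Σ_{T∖W} A e^{sh} ∕ Σ_{T∖W} A`, `Σ_{T∖W} B e^{sh} ∕ Σ_{T∖W} B`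
(`h = log B − log A`; radius `r`, bounds `B_A, B_B`) and the regime ONLY of the tame-restricted laws; then
`1 − Σ_T √(p_A p_B) ≤ max(Σ_W A∕Σ_T A, Σ_W B∕Σ_T B) + (B_A + B_B)∕(2r²)`:
WILD classes cost the larger of their two ONE-RUN masses and nothing else; TAME classes cost two one-run tilt bounds over `r²`.
This is the statement the card's prose means («on wild classes nothing is claimed — they are paid by mass») and the ed.4 patch CRIT-1 asked for. -/
theorem one_sub_affinity_classLaw_le_wildMass_add_tameTilts [DecidableEq ι] {W : Finset ι} (hW : W ⊆ T)
    (hA : ∀ τ ∈ T, 0 < A τ) (hB : ∀ τ ∈ T, 0 < B τ)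
    {r BA BB : ℝ} (hr : 0 < r) (φA φB : ℂ → ℂ)
    (hφA : DifferentiableOn ℂ φA (Metric.closedBall 0 r)) (hφB : DifferentiableOn ℂ φB (Metric.closedBall 0 r))
    (hexpA : ∀ s ∈ Metric.closedBall (0:ℂ) r, Complex.exp (φA s)
      = (∑ τ ∈ T \ W, (A τ : ℂ) * Complex.exp (s * ((Real.log (B τ) - Real.log (A τ) : ℝ) : ℂ))) / ∑ τ ∈ T \ W, (A τ : ℂ))
    (hexpB : ∀ s ∈ Metric.closedBall (0:ℂ) r, Complex.exp (φB s)
      = (∑ τ ∈ T \ W, (B τ : ℂ) * Complex.exp (s * ((Real.log (B τ) - Real.log (A τ) : ℝ) : ℂ))) / ∑ τ ∈ T \ W, (B τ : ℂ))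
    (hbA : ∀ s ∈ Metric.closedBall (0:ℂ) r, ‖φA s‖ ≤ BA) (hbB : ∀ s ∈ Metric.closedBall (0:ℂ) r, ‖φB s‖ ≤ BB)
    (hreg : 1 - ∑ τ ∈ T \ W, Real.sqrt ((A τ / ∑ σ ∈ T \ W, A σ) * (B τ / ∑ σ ∈ T \ W, B σ)) ≤ 1 / 16) :
    1 - ∑ τ ∈ T, Real.sqrt ((A τ / ∑ σ ∈ T, A σ) * (B τ / ∑ σ ∈ T, B σ))
      ≤ max ((∑ τ ∈ W, A τ) / ∑ σ ∈ T, A σ) ((∑ τ ∈ W, B τ) / ∑ σ ∈ T, B σ) + (BA + BB) / (2 * r ^ 2) := by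
  -- the tame set is nonempty (else the regime hypothesis reads `1 ≤ 1∕16`)
  have hne : (T \ W).Nonempty := by
    rcases (T \ W).eq_empty_or_nonempty with h0 | h1
    · exfalso; rw [h0] at hreg; simp at hreg; norm_num at hreg
    · exact h1
  have h1 := one_sub_affinity_classLaw_le_wildMass_add_restricted hW hA hB hne
  have h2 := one_sub_affinity_classLaw_le_of_analytic_tilts (S := T \ W)
    (fun τ hτ => hA τ (sdiff_subset hτ)) (fun τ hτ => hB τ (sdiff_subset hτ)) hr φA φB hφA hφB hexpA hexpB hbA hbB hreg
  linarith

/-- **… in HELLINGER (square-root) currency** [folklore]: under the same hypotheses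
`√(1 − Σ_T √(p_A p_B)) ≤ √(max(Σ_W A∕Σ_T A, Σ_W B∕Σ_T B)) + √((B_A + B_B)∕2)∕r` — the summand shape of the K-summation (§5). -/
theorem sqrt_one_sub_affinity_classLaw_le_wildMass_add_tameTilts [DecidableEq ι] {W : Finset ι} (hW : W ⊆ T)
    (hA : ∀ τ ∈ T, 0 < A τ) (hB : ∀ τ ∈ T, 0 < B τ)
    {r BA BB : ℝ} (hr : 0 < r) (φA φB : ℂ → ℂ)
    (hφA : DifferentiableOn ℂ φA (Metric.closedBall 0 r)) (hφB : DifferentiableOn ℂ φB (Metric.closedBall 0 r))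
    (hexpA : ∀ s ∈ Metric.closedBall (0:ℂ) r, Complex.exp (φA s)
      = (∑ τ ∈ T \ W, (A τ : ℂ) * Complex.exp (s * ((Real.log (B τ) - Real.log (A τ) : ℝ) : ℂ))) / ∑ τ ∈ T \ W, (A τ : ℂ))
    (hexpB : ∀ s ∈ Metric.closedBall (0:ℂ) r, Complex.exp (φB s)
      = (∑ τ ∈ T \ W, (B τ : ℂ) * Complex.exp (s * ((Real.log (B τ) - Real.log (A τ) : ℝ) : ℂ))) / ∑ τ ∈ T \ W, (B τ : ℂ))
    (hbA : ∀ s ∈ Metric.closedBall (0:ℂ) r, ‖φA s‖ ≤ BA) (hbB : ∀ s ∈ Metric.closedBall (0:ℂ) r, ‖φB s‖ ≤ BB)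
    (hreg : 1 - ∑ τ ∈ T \ W, Real.sqrt ((A τ / ∑ σ ∈ T \ W, A σ) * (B τ / ∑ σ ∈ T \ W, B σ)) ≤ 1 / 16) :
    Real.sqrt (1 - ∑ τ ∈ T, Real.sqrt ((A τ / ∑ σ ∈ T, A σ) * (B τ / ∑ σ ∈ T, B σ)))
      ≤ Real.sqrt (max ((∑ τ ∈ W, A τ) / ∑ σ ∈ T, A σ) ((∑ τ ∈ W, B τ) / ∑ σ ∈ T, B σ))
        + Real.sqrt ((BA + BB) / 2) / r := by
  have h := one_sub_affinity_classLaw_le_wildMass_add_tameTilts hW hA hB hr φA φB hφA hφB hexpA hexpB hbA hbB hreg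
  have hT : T.Nonempty := by
    rcases (T \ W).eq_empty_or_nonempty with h0 | h1
    · exfalso; rw [h0] at hreg; simp at hreg; norm_num at hreg
    · exact h1.mono sdiff_subset
  have hZA : 0 < ∑ σ ∈ T, A σ := sum_pos hA hT
  have hm0 : 0 ≤ max ((∑ τ ∈ W, A τ) / ∑ σ ∈ T, A σ) ((∑ τ ∈ W, B τ) / ∑ σ ∈ T, B σ) :=
    le_trans (div_nonneg (sum_nonneg fun τ hτ => (hA τ (hW hτ)).le) hZA.le) (le_max_left _ _)
  -- `B_A + B_B ≥ 0` is forced: a norm bound at the centre of the disc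
  have h0 : (0:ℂ) ∈ Metric.closedBall (0:ℂ) r := Metric.mem_closedBall_self hr.le
  have hBA0 : 0 ≤ BA := (norm_nonneg _).trans (hbA 0 h0)
  have hBB0 : 0 ≤ BB := (norm_nonneg _).trans (hbB 0 h0)
  have htil : 0 ≤ (BA + BB) / (2 * r ^ 2) := by positivity
  -- `√(a + b) ≤ √a + √b` (the tree's MRT2015 lemma of that name, inlined to keep the imports local)
  have hsub : ∀ {a b : ℝ}, 0 ≤ a → 0 ≤ b → Real.sqrt (a + b) ≤ Real.sqrt a + Real.sqrt b := fun {a b} ha hb => by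
    rw [Real.sqrt_le_left (by positivity)]
    nlinarith [Real.sq_sqrt ha, Real.sq_sqrt hb, mul_nonneg (Real.sqrt_nonneg a) (Real.sqrt_nonneg b)]
  calc Real.sqrt (1 - ∑ τ ∈ T, Real.sqrt ((A τ / ∑ σ ∈ T, A σ) * (B τ / ∑ σ ∈ T, B σ)))
      ≤ Real.sqrt (max ((∑ τ ∈ W, A τ) / ∑ σ ∈ T, A σ) ((∑ τ ∈ W, B τ) / ∑ σ ∈ T, B σ) + (BA + BB) / (2 * r ^ 2)) :=
        Real.sqrt_le_sqrt h
    _ ≤ Real.sqrt (max ((∑ τ ∈ W, A τ) / ∑ σ ∈ T, A σ) ((∑ τ ∈ W, B τ) / ∑ σ ∈ T, B σ))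
          + Real.sqrt ((BA + BB) / (2 * r ^ 2)) := hsub hm0 htil
    _ = Real.sqrt (max ((∑ τ ∈ W, A τ) / ∑ σ ∈ T, A σ) ((∑ τ ∈ W, B τ) / ∑ σ ∈ T, B σ))
          + Real.sqrt ((BA + BB) / 2) / r := by
        rw [show (BA + BB) / (2 * r ^ 2) = ((BA + BB) / 2) / r ^ 2 by ring,
          Real.sqrt_div' _ (by positivity : (0:ℝ) ≤ r ^ 2), Real.sqrt_sq hr.le]

/-- **THE TAME REGIME FROM COARSE CLOSENESS** [folklore; idea-3 ed.3's `regime_of_wild_add_sup` at `W := ∅`, read on the tame-restricted weights]: on a nonempty finite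
class set `S` with positive weights, a UNIFORM (not small-in-`K`) bound `|h_τ − c| ≤ ¼` on the centred increment (`h = log B − log A`, `c = log Σ_S B − log Σ_S A`) gives
the regime `1 − Σ_S √(p_A p_B) ≤ 1∕16` (indeed `≤ 1∕64`: dag-n20-w5's `one_sub_affinity_le_wildMass_add_logMoment` at `W := ∅` and `Σ(p+q) = 2`).  So the regime
hypothesis of §1 is NO NEW LETTER: with `S := T ∖ W` it is (V‑b)'s termwise smallness on TAME classes, from some `K₀` on. -/
theorem tameRegime_of_sup_centredIncrement {S : Finset ι} {A B : ι → ℝ} (hS : S.Nonempty)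
    (hA : ∀ τ ∈ S, 0 < A τ) (hB : ∀ τ ∈ S, 0 < B τ)
    (hsup : ∀ τ ∈ S, |(Real.log (B τ) - Real.log (A τ)) - (Real.log (∑ σ ∈ S, B σ) - Real.log (∑ σ ∈ S, A σ))| ≤ 1 / 4) :
    1 - ∑ τ ∈ S, Real.sqrt ((A τ / ∑ σ ∈ S, A σ) * (B τ / ∑ σ ∈ S, B σ)) ≤ 1 / 16 := by
  classical
  have hZA : 0 < ∑ σ ∈ S, A σ := sum_pos hA hS
  have hZB : 0 < ∑ σ ∈ S, B σ := sum_pos hB hS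
  have hp : ∀ τ ∈ S, 0 ≤ A τ / ∑ σ ∈ S, A σ := fun τ hτ => div_nonneg (hA τ hτ).le hZA.le
  have hq : ∀ τ ∈ S, 0 ≤ B τ / ∑ σ ∈ S, B σ := fun τ hτ => div_nonneg (hB τ hτ).le hZB.le
  have hp1 : ∑ τ ∈ S, A τ / ∑ σ ∈ S, A σ = 1 := by rw [← sum_div, div_self hZA.ne']
  have hq1 : ∑ τ ∈ S, B τ / ∑ σ ∈ S, B σ = 1 := by rw [← sum_div, div_self hZB.ne']
  have hp' : ∀ τ ∈ S \ ∅, 0 < A τ / ∑ σ ∈ S, A σ := fun τ hτ => div_pos (hA τ (sdiff_subset hτ)) hZA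
  have hq' : ∀ τ ∈ S \ ∅, 0 < B τ / ∑ σ ∈ S, B σ := fun τ hτ => div_pos (hB τ (sdiff_subset hτ)) hZB
  have hV := one_sub_affinity_le_wildMass_add_logMoment (p := fun τ => A τ / ∑ σ ∈ S, A σ)
    (q := fun τ => B τ / ∑ σ ∈ S, B σ) hp hq hp1 hq1 (W := ∅) (empty_subset S) hp' hq'
  rw [sum_empty, zero_div, zero_add, sdiff_empty] at hV
  have h2 : ∑ τ ∈ S, (A τ / ∑ σ ∈ S, A σ + B τ / ∑ σ ∈ S, B σ)
        * (Real.log (A τ / ∑ σ ∈ S, A σ) - Real.log (B τ / ∑ σ ∈ S, B σ)) ^ 2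
      ≤ ∑ τ ∈ S, (A τ / ∑ σ ∈ S, A σ + B τ / ∑ σ ∈ S, B σ) * (1 / 16) := by
    refine sum_le_sum fun τ hτ => mul_le_mul_of_nonneg_left ?_ (add_nonneg (hp τ hτ) (hq τ hτ))
    have e : Real.log (A τ / ∑ σ ∈ S, A σ) - Real.log (B τ / ∑ σ ∈ S, B σ)
        = -((Real.log (B τ) - Real.log (A τ)) - (Real.log (∑ σ ∈ S, B σ) - Real.log (∑ σ ∈ S, A σ))) := by
      rw [Real.log_div (hA τ hτ).ne' hZA.ne', Real.log_div (hB τ hτ).ne' hZB.ne']; ring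
    rw [e, neg_sq, ← sq_abs]
    have hs := hsup τ hτ
    nlinarith [abs_nonneg ((Real.log (B τ) - Real.log (A τ)) - (Real.log (∑ σ ∈ S, B σ) - Real.log (∑ σ ∈ S, A σ)))]
  have h3 : ∑ τ ∈ S, (A τ / ∑ σ ∈ S, A σ + B τ / ∑ σ ∈ S, B σ) * (1 / 16) = 2 * (1 / 16) := by
    rw [← sum_mul, sum_add_distrib, hp1, hq1]; ring
  linarith

end Composition

/-! ## §2 The K-summation: a √-SUMMABLE affinity-defect letter from per-key wild masses, radii, ONE tame tilt bound and the tame regime [folklore] -/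

section Summation
variable [DecidableEq ι] {l₀ : ℝ}

/-- **★★ THE HELLINGER LETTER ALONG `K` FROM WILD MASS AND TAME TILTS** [folklore; = idea-3 ed.3 §12 `hellingerRate_of_tilts`, R2-REPAIRED: the tilt and
regime letters are asked of the TAME-RESTRICTED class sums only, the wild sets enter through their one-run masses].  On the carrier shapes of the key
(`T : ℕ → Finset ι`, `A B : ℕ → ℝ → ι → ℝ` positive on `|t| ≤ l₀`): wild sets `W K t ⊆ T K`, per-key bounds `wm_K` on BOTH one-run wild masses with
`Σ_K √wm_K < ∞`, tilt radii `r_K > 0` with `Σ_K 1∕r_K < ∞` (with (V‑b)'s `η_K`: `r_K = r₀∕η_K`), ONE bound `𝔅` for the two tame tilts at every `(K,t)`, and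
the tame regime from some `K₀` on, give `η ≥ 0` with `Σ_K √η_K < ∞` and `1 − Σ_{T K} √(p_{A,K,t}·p_{B,K,t}) ≤ η_K` for all `K` and `|t| ≤ l₀` —
the per-key affinity-defect letter (H) consumed by the landed class-law∕TV roads (dag-n19-w2 `abs_classLawGap_le_sqrt_one_sub_affinity_sq`,
dag-n20-w4 `exists_hybridNE7_of_target_of_classLawTV`, dag-n20-w5's endpoint road).  `η_K = wm_K + 𝔅∕r_K² (+ 1 on the finite head `K < K₀`)`.
HONEST: `Σ√wm_K < ∞` ((V‑a)), `Σ 1∕r_K < ∞` ((V‑b) = (YG), two-run, UNPRINTED for d = 4), the tame tilts ((KR) on tame components) and the regime are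
HYPOTHESES produced by nobody here. -/
theorem affinityDefectLetter_of_tameTilts (T : ℕ → Finset ι) (A B : ℕ → ℝ → ι → ℝ)
    (hA : ∀ K t, |t| ≤ l₀ → ∀ τ ∈ T K, 0 < A K t τ) (hB : ∀ K t, |t| ≤ l₀ → ∀ τ ∈ T K, 0 < B K t τ)
    (W : ℕ → ℝ → Finset ι) (hW : ∀ K t, W K t ⊆ T K)
    (wm : ℕ → ℝ) (hwm : ∀ K, 0 ≤ wm K)
    (hwildA : ∀ K t, |t| ≤ l₀ → (∑ τ ∈ W K t, A K t τ) / (∑ σ ∈ T K, A K t σ) ≤ wm K)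
    (hwildB : ∀ K t, |t| ≤ l₀ → (∑ τ ∈ W K t, B K t τ) / (∑ σ ∈ T K, B K t σ) ≤ wm K)
    (hws : Summable fun K => Real.sqrt (wm K))
    (r : ℕ → ℝ) (hr : ∀ K, 0 < r K) (hrs : Summable fun K => 1 / r K)
    {𝔅 : ℝ} (h𝔅 : 0 ≤ 𝔅)
    (htilt : ∀ K t, |t| ≤ l₀ → ∃ φA φB : ℂ → ℂ,
      DifferentiableOn ℂ φA (Metric.closedBall 0 (r K)) ∧ DifferentiableOn ℂ φB (Metric.closedBall 0 (r K)) ∧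
      (∀ s ∈ Metric.closedBall (0:ℂ) (r K), Complex.exp (φA s)
        = (∑ τ ∈ T K \ W K t, (A K t τ : ℂ) * Complex.exp (s * ((Real.log (B K t τ) - Real.log (A K t τ) : ℝ) : ℂ)))
            / ∑ τ ∈ T K \ W K t, (A K t τ : ℂ)) ∧
      (∀ s ∈ Metric.closedBall (0:ℂ) (r K), Complex.exp (φB s)
        = (∑ τ ∈ T K \ W K t, (B K t τ : ℂ) * Complex.exp (s * ((Real.log (B K t τ) - Real.log (A K t τ) : ℝ) : ℂ)))
            / ∑ τ ∈ T K \ W K t, (B K t τ : ℂ)) ∧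
      (∀ s ∈ Metric.closedBall (0:ℂ) (r K), ‖φA s‖ ≤ 𝔅) ∧ (∀ s ∈ Metric.closedBall (0:ℂ) (r K), ‖φB s‖ ≤ 𝔅))
    (K₀ : ℕ) (hreg : ∀ K, K₀ ≤ K → ∀ t, |t| ≤ l₀ →
      1 - ∑ τ ∈ T K \ W K t, Real.sqrt ((A K t τ / ∑ σ ∈ T K \ W K t, A K t σ) * (B K t τ / ∑ σ ∈ T K \ W K t, B K t σ))
        ≤ 1 / 16) :
    ∃ η : ℕ → ℝ, (∀ K, 0 ≤ η K) ∧ Summable (fun K => Real.sqrt (η K)) ∧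
      ∀ K t, |t| ≤ l₀ →
        1 - ∑ τ ∈ T K, Real.sqrt ((A K t τ / ∑ σ ∈ T K, A K t σ) * (B K t τ / ∑ σ ∈ T K, B K t σ)) ≤ η K := by
  refine ⟨fun K => wm K + 𝔅 / r K ^ 2 + (if K < K₀ then (1:ℝ) else 0), ?_, ?_, ?_⟩
  · intro K
    have hwmK := hwm K
    have hrK := hr K
    have hind : 0 ≤ (if K < K₀ then (1:ℝ) else 0) := by split_ifs <;> norm_num
    positivity
  · -- `√η_K ≤ √wm_K + √𝔅·(1∕r_K) + 𝟙[K < K₀]`, each summable (`√(a + b) ≤ √a + √b` inlined, as in FILE 1a)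
    have hsub : ∀ {a b : ℝ}, 0 ≤ a → 0 ≤ b → Real.sqrt (a + b) ≤ Real.sqrt a + Real.sqrt b := fun {a b} ha hb => by
      rw [Real.sqrt_le_left (by positivity)]
      nlinarith [Real.sq_sqrt ha, Real.sq_sqrt hb, mul_nonneg (Real.sqrt_nonneg a) (Real.sqrt_nonneg b)]
    have hhead : Summable fun K => (if K < K₀ then (1:ℝ) else 0) := by
      refine summable_of_ne_finset_zero (s := Finset.range K₀) fun K hK => ?_
      rw [Finset.mem_range] at hK
      simp [hK]
    refine Summable.of_nonneg_of_le (fun K => Real.sqrt_nonneg _) (fun K => ?_) ((hws.add (hrs.mul_left (Real.sqrt 𝔅))).add hhead)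
    have hrK := hr K
    have hwmK := hwm K
    have hind : 0 ≤ (if K < K₀ then (1:ℝ) else 0) := by split_ifs <;> norm_num
    have hind' : Real.sqrt (if K < K₀ then (1:ℝ) else 0) = (if K < K₀ then (1:ℝ) else 0) := by
      split_ifs <;> simp
    have hq0 : (0:ℝ) ≤ 𝔅 / r K ^ 2 := by positivity
    have hs0 : (0:ℝ) ≤ wm K + 𝔅 / r K ^ 2 := by positivity
    calc Real.sqrt (wm K + 𝔅 / r K ^ 2 + (if K < K₀ then (1:ℝ) else 0))
        ≤ Real.sqrt (wm K + 𝔅 / r K ^ 2) + Real.sqrt (if K < K₀ then (1:ℝ) else 0) :=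
          hsub hs0 hind
      _ ≤ (Real.sqrt (wm K) + Real.sqrt (𝔅 / r K ^ 2)) + (if K < K₀ then (1:ℝ) else 0) := by
          rw [hind']; exact add_le_add (hsub hwmK hq0) le_rfl
      _ = Real.sqrt (wm K) + Real.sqrt 𝔅 * (1 / r K) + (if K < K₀ then (1:ℝ) else 0) := by
          rw [Real.sqrt_div' _ (by positivity : (0:ℝ) ≤ r K ^ 2), Real.sqrt_sq hrK.le]; ring
  · intro K t ht
    beta_reduce
    have hind : 0 ≤ (if K < K₀ then (1:ℝ) else 0) := by split_ifs <;> norm_num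
    have hrK := hr K
    by_cases hK : K < K₀
    · -- on the finite head the letter is the trivial bound `1 − 𝒜 ≤ 1`
      simp only [hK, if_true]
      have h0 : 0 ≤ ∑ τ ∈ T K, Real.sqrt ((A K t τ / ∑ σ ∈ T K, A K t σ) * (B K t τ / ∑ σ ∈ T K, B K t σ)) :=
        sum_nonneg fun _ _ => Real.sqrt_nonneg _
      have : 0 ≤ 𝔅 / r K ^ 2 := by positivity
      linarith [hwm K]
    · simp only [hK, if_false, add_zero]
      obtain ⟨φA, φB, hφA, hφB, heA, heB, hbA, hbB⟩ := htilt K t ht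
      have h1 := one_sub_affinity_classLaw_le_wildMass_add_tameTilts (T := T K) (hW K t) (hA K t ht) (hB K t ht) (hr K)
        φA φB hφA hφB heA heB hbA hbB (hreg K (not_lt.1 hK) t ht)
      have hmax : max ((∑ τ ∈ W K t, A K t τ) / ∑ σ ∈ T K, A K t σ) ((∑ τ ∈ W K t, B K t τ) / ∑ σ ∈ T K, B K t σ) ≤ wm K :=
        max_le (hwildA K t ht) (hwildB K t ht)
      have e : (𝔅 + 𝔅) / (2 * r K ^ 2) = 𝔅 / r K ^ 2 := by field_simp; ring
      linarith [e ▸ h1]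

/-- Bookkeeping [folklore]: a √-summable dominating letter `η` for nonnegative quantities `x K t` is a SUMMABLE Hellinger-rate `ρ_K = √η_K` with
`√(x K t) ≤ ρ_K` — the hypothesis shape of the per-set-TV road (`ρ` summable) from the (H)-letter shape of the theorem above. -/
theorem exists_summable_sqrt_rate {x : ℕ → ℝ → ℝ} {η : ℕ → ℝ}
    (hs : Summable fun K => Real.sqrt (η K)) (hx : ∀ K t, |t| ≤ l₀ → x K t ≤ η K) :
    ∃ ρ : ℕ → ℝ, Summable ρ ∧ (∀ K, 0 ≤ ρ K) ∧ ∀ K t, |t| ≤ l₀ → Real.sqrt (x K t) ≤ ρ K :=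
  ⟨fun K => Real.sqrt (η K), hs, fun _ => Real.sqrt_nonneg _, fun K t ht => Real.sqrt_le_sqrt (hx K t ht)⟩

/-- **★ COROLLARY — THE SUMMABLE HELLINGER RATE** [folklore]: under the hypotheses of `affinityDefectLetter_of_tameTilts` there is a SUMMABLE `ρ ≥ 0`
with `√(1 − Σ_{T K} √(p_{A,K,t}·p_{B,K,t})) ≤ ρ_K` for all `K` and `|t| ≤ l₀` — idea-3 ed.3's conclusion shape (`hellingerRate_of_tilts`), now
with the tilt letter where (KR)+(V‑b) can supply it. -/
theorem hellingerRate_of_tameTilts (T : ℕ → Finset ι) (A B : ℕ → ℝ → ι → ℝ)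
    (hA : ∀ K t, |t| ≤ l₀ → ∀ τ ∈ T K, 0 < A K t τ) (hB : ∀ K t, |t| ≤ l₀ → ∀ τ ∈ T K, 0 < B K t τ)
    (W : ℕ → ℝ → Finset ι) (hW : ∀ K t, W K t ⊆ T K)
    (wm : ℕ → ℝ) (hwm : ∀ K, 0 ≤ wm K)
    (hwildA : ∀ K t, |t| ≤ l₀ → (∑ τ ∈ W K t, A K t τ) / (∑ σ ∈ T K, A K t σ) ≤ wm K)
    (hwildB : ∀ K t, |t| ≤ l₀ → (∑ τ ∈ W K t, B K t τ) / (∑ σ ∈ T K, B K t σ) ≤ wm K)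
    (hws : Summable fun K => Real.sqrt (wm K))
    (r : ℕ → ℝ) (hr : ∀ K, 0 < r K) (hrs : Summable fun K => 1 / r K)
    {𝔅 : ℝ} (h𝔅 : 0 ≤ 𝔅)
    (htilt : ∀ K t, |t| ≤ l₀ → ∃ φA φB : ℂ → ℂ,
      DifferentiableOn ℂ φA (Metric.closedBall 0 (r K)) ∧ DifferentiableOn ℂ φB (Metric.closedBall 0 (r K)) ∧
      (∀ s ∈ Metric.closedBall (0:ℂ) (r K), Complex.exp (φA s)
        = (∑ τ ∈ T K \ W K t, (A K t τ : ℂ) * Complex.exp (s * ((Real.log (B K t τ) - Real.log (A K t τ) : ℝ) : ℂ)))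
            / ∑ τ ∈ T K \ W K t, (A K t τ : ℂ)) ∧
      (∀ s ∈ Metric.closedBall (0:ℂ) (r K), Complex.exp (φB s)
        = (∑ τ ∈ T K \ W K t, (B K t τ : ℂ) * Complex.exp (s * ((Real.log (B K t τ) - Real.log (A K t τ) : ℝ) : ℂ)))
            / ∑ τ ∈ T K \ W K t, (B K t τ : ℂ)) ∧
      (∀ s ∈ Metric.closedBall (0:ℂ) (r K), ‖φA s‖ ≤ 𝔅) ∧ (∀ s ∈ Metric.closedBall (0:ℂ) (r K), ‖φB s‖ ≤ 𝔅))
    (K₀ : ℕ) (hreg : ∀ K, K₀ ≤ K → ∀ t, |t| ≤ l₀ →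
      1 - ∑ τ ∈ T K \ W K t, Real.sqrt ((A K t τ / ∑ σ ∈ T K \ W K t, A K t σ) * (B K t τ / ∑ σ ∈ T K \ W K t, B K t σ))
        ≤ 1 / 16) :
    ∃ ρ : ℕ → ℝ, Summable ρ ∧ (∀ K, 0 ≤ ρ K) ∧ ∀ K t, |t| ≤ l₀ →
      Real.sqrt (1 - ∑ τ ∈ T K, Real.sqrt ((A K t τ / ∑ σ ∈ T K, A K t σ) * (B K t τ / ∑ σ ∈ T K, B K t σ))) ≤ ρ K := by
  obtain ⟨η, _, hs, hη⟩ := affinityDefectLetter_of_tameTilts T A B hA hB W hW wm hwm hwildA hwildB hws r hr hrs h𝔅 htilt K₀ hreg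
  exact exists_summable_sqrt_rate hs hη

end Summation

end Summit.QuantumFields.YangMills.BalabanUVNodes.N19TameConditionedHellingerLetterAlongK

end
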